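import Literature.MathematicalPhysics.QuantumLattice.CloverPseudoscalar
import HarnessLib

/-!
# The clover densities `S_x`, `P_x` as local gauge-invariant observables of lattice gauge theory

Topic `Literature/MathematicalPhysics/QuantumLattice`, companion of `CloverPseudoscalar.lean`
(definition request `defn-cloverPseudoscalar`, route `DualityDefect` of `QuantumFields/YangMills`).

For a continuous unitary representation `ρ` of the compact gauge group `G`, the bare clover field
tensor `C_{μν}(x) = flowedClover ρ 0 U x μ ν` [Luscher2010, §3.2 Fig. 1], the clover action density
`S_x = flowedCloverEnergy ρ 0 x U = ∑_{μ<ν} Re tr(C†C)` (`0⁺⁺`) and the clover pseudoscalar density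
`P_x = cloverPseudoscalar ρ x U = −2 Re tr(C₀₁C₂₃ − C₀₂C₁₃ + C₀₃C₁₂)` (`0⁻⁺`, [MuzinichNair1986])
are continuous (product topology), bounded and measurable (product σ-algebra, `G` second
countable) functions of the configuration; together with gauge invariance and locality
(`CloverPseudoscalar.lean`) this packages them, for a lattice representation `r : LatticeRep G`
(faithful continuous unitary; second countability of `G` then comes from the closed embedding
`r.ρ`, as for the tree's `LatticeRep.curvature`), as local gauge-invariant observables on `ℤ⁴`:

* `cloverPseudoscalarObservable r : LocalGaugeObservable 4 G` (`= YMSpecies G`), `F = P₀`;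
* `cloverEnergyObservable r : LocalGaugeObservable 4 G`, `F = S₀`;

both with support `cloverSiteEdges 0` (the links of the six clovers through the origin).
Everything stated is proved. [Luscher2010] [MuzinichNair1986]
-/

noncomputable section

open Matrix

namespace Literature.MathematicalPhysics.QuantumLattice

/-! ### Continuity, boundedness, measurability -/

section MatrixLevel

variable {d : ℕ} {R : Type*} {N : ℕ}

/-- `Q_{μν}(x)` is a continuous (polynomial) function of the link field. [folklore] -/
@[fun_prop]
theorem continuous_cloverLeafSum [AddGroup R] [One R] (x : Fin d → R) (μ ν : Fin d) :
    Continuous fun V : MatrixLinkField d R N => cloverLeafSum V x μ ν := by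
  unfold cloverLeafSum
  fun_prop


end MatrixLevel

section GroupLevel

variable {d : ℕ} {R : Type*} {N : ℕ} {G : Type*} [Group G] [TopologicalSpace G]
  (ρ : G →* Matrix (Fin N) (Fin N) ℂ)

/-- For continuous `ρ` the bare clover is a continuous function of the configuration (product
topology). [folklore] -/
theorem continuous_flowedClover_zero [AddGroup R] [One R] (hρc : Continuous ρ) (x : Fin d → R)
    (μ ν : Fin d) : Continuous fun U : (Fin d → R) × Fin d → G => flowedClover ρ 0 U x μ ν := by
  simp only [flowedClover_zero]
  fun_prop

/-- `P_x` is continuous for continuous `ρ`. [folklore] -/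
theorem continuous_cloverPseudoscalar [AddGroup R] [One R] (hρc : Continuous ρ) (x : Fin 4 → R) :
    Continuous fun U : (Fin 4 → R) × Fin 4 → G => cloverPseudoscalar ρ x U := by
  have h := continuous_flowedClover_zero ρ hρc x
  unfold cloverPseudoscalar
  refine continuous_const.mul (Complex.continuous_re.comp (Continuous.matrix_trace ?_))
  exact (((h 0 1).mul (h 2 3)).sub ((h 0 2).mul (h 1 3))).add ((h 0 3).mul (h 1 2))

/-- `S_x` (flow time `0`) is continuous for continuous `ρ`. [folklore] -/
theorem continuous_flowedCloverEnergy_zero [AddGroup R] [One R] (hρc : Continuous ρ)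
    (x : Fin d → R) : Continuous fun U : (Fin d → R) × Fin d → G => flowedCloverEnergy ρ 0 x U := by
  have h := continuous_flowedClover_zero ρ hρc x
  unfold flowedCloverEnergy
  refine continuous_finsetSum _ fun μ _ => continuous_finsetSum _ fun ν _ => ?_
  split_ifs
  · exact Complex.continuous_re.comp (Continuous.matrix_trace ((h μ ν).matrix_conjTranspose.mul (h μ ν)))
  · exact continuous_const

/-- `P_x` is bounded when `G` is compact and `ρ` continuous. [folklore] -/
theorem exists_abs_cloverPseudoscalar_le [AddGroup R] [One R] [CompactSpace G] (hρc : Continuous ρ)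
    (x : Fin 4 → R) : ∃ C, ∀ U : (Fin 4 → R) × Fin 4 → G, |cloverPseudoscalar ρ x U| ≤ C := by
  obtain ⟨C, hC⟩ := (isCompact_univ.image
    (continuous_abs.comp (continuous_cloverPseudoscalar ρ hρc x))).isBounded.bddAbove
  exact ⟨C, fun U => hC ⟨U, Set.mem_univ _, rfl⟩⟩

/-- `S_x` is bounded when `G` is compact and `ρ` continuous. [folklore] -/
theorem exists_abs_flowedCloverEnergy_zero_le [AddGroup R] [One R] [CompactSpace G]
    (hρc : Continuous ρ) (x : Fin d → R) :
    ∃ C, ∀ U : (Fin d → R) × Fin d → G, |flowedCloverEnergy ρ 0 x U| ≤ C := by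
  obtain ⟨C, hC⟩ := (isCompact_univ.image
    (continuous_abs.comp (continuous_flowedCloverEnergy_zero ρ hρc x))).isBounded.bddAbove
  exact ⟨C, fun U => hC ⟨U, Set.mem_univ _, rfl⟩⟩

variable [MeasurableSpace G] [BorelSpace G] [SecondCountableTopology G] [Countable R]

/-- `P_x` is measurable (product σ-algebra) for continuous `ρ` on a second-countable `G`. [folklore] -/
theorem measurable_cloverPseudoscalar [AddGroup R] [One R] (hρc : Continuous ρ) (x : Fin 4 → R) :
    Measurable fun U : (Fin 4 → R) × Fin 4 → G => cloverPseudoscalar ρ x U := by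
  exact (continuous_cloverPseudoscalar ρ hρc x).measurable

/-- `S_x` (flow time `0`) is measurable for continuous `ρ` on a second-countable `G`. [folklore] -/
theorem measurable_flowedCloverEnergy_zero [AddGroup R] [One R] (hρc : Continuous ρ)
    (x : Fin d → R) : Measurable fun U : (Fin d → R) × Fin d → G => flowedCloverEnergy ρ 0 x U := by
  exact (continuous_flowedCloverEnergy_zero ρ hρc x).measurable


end GroupLevel

/-! ### The packaged observables on `ℤ⁴` -/

section Observables

open Literature.MathematicalPhysics.QuantumFieldTheory (LatticeRep)
open Literature.Probability.LatticeModels (Site)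

variable {G : Type*} [Group G] [TopologicalSpace G] [CompactSpace G] [MeasurableSpace G]
  [BorelSpace G]

/-- **The clover pseudoscalar density at the origin as a local gauge-invariant observable of
lattice `G`-gauge theory on `ℤ⁴`** (a `YMSpecies G`), for a lattice representation `r` (faithful
continuous unitary): the `0⁻⁺` channel of route `DualityDefect`. Second countability of `G` (for
measurability) comes from the closed embedding `r.ρ`. [cite: MuzinichNair1986, eqs. (5)–(10)] -/
def cloverPseudoscalarObservable (r : LatticeRep G) : LocalGaugeObservable 4 G :=
  haveI : SecondCountableTopology G :=
    (r.continuous.isClosedEmbedding r.injective).isEmbedding.secondCountableTopology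
  { F := fun U => cloverPseudoscalar r.ρ 0 U
    supp := cloverSiteEdges (0 : Site 4)
    isCylinder := isCylinder_cloverPseudoscalar r.ρ 0
    gaugeInvariant := isZdGaugeInvariant_cloverPseudoscalar r.ρ r.mem_unitary 0
    bounded := exists_abs_cloverPseudoscalar_le r.ρ r.continuous 0
    measurable := measurable_cloverPseudoscalar r.ρ r.continuous 0 }

/-- **The clover action density `S = ∑_{μ<ν} Re tr(C†C)` at the origin as a local gauge-invariant
observable on `ℤ⁴`** (the `0⁺⁺` channel of route `DualityDefect`). [cite: Luscher2010, eq. (2.1) and §3.2] -/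
def cloverEnergyObservable (r : LatticeRep G) : LocalGaugeObservable 4 G :=
  haveI : SecondCountableTopology G :=
    (r.continuous.isClosedEmbedding r.injective).isEmbedding.secondCountableTopology
  { F := fun U => flowedCloverEnergy r.ρ 0 0 U
    supp := cloverSiteEdges (0 : Site 4)
    isCylinder := isCylinder_flowedCloverEnergy_zero r.ρ 0
    gaugeInvariant := isZdGaugeInvariant_flowedCloverEnergy_zero r.ρ r.mem_unitary 0
    bounded := exists_abs_flowedCloverEnergy_zero_le r.ρ r.continuous 0
    measurable := measurable_flowedCloverEnergy_zero r.ρ r.continuous 0 }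

/-- The underlying function of `cloverPseudoscalarObservable r` is `P₀ = cloverPseudoscalar r.ρ 0`. [folklore] -/
@[simp]
theorem cloverPseudoscalarObservable_F (r : LatticeRep G) (U : LGConfig 4 G) :
    (cloverPseudoscalarObservable r).F U = cloverPseudoscalar r.ρ 0 U := rfl

/-- The underlying function of `cloverEnergyObservable r` is `S₀ = flowedCloverEnergy r.ρ 0 0`. [folklore] -/
@[simp]
theorem cloverEnergyObservable_F (r : LatticeRep G) (U : LGConfig 4 G) :
    (cloverEnergyObservable r).F U = flowedCloverEnergy r.ρ 0 0 U := rfl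

end Observables

end Literature.MathematicalPhysics.QuantumLattice

end
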